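import Summits.QuantumFields.BalabanUV.Beta.FP.SliceLeibnizChain
import Mathlib.Data.Nat.Choose.Sum
import Mathlib.Algebra.BigOperators.NatAntidiagonal

/-!
# `BalabanUV.Beta.FP.SliceChainN` — road «FP» for binder row D1, leaf H2-P of the horizontal route, sub-row H2-P-CHAIN-N (owner assignment of
# 2026-08-20 following R-FP-21 (B2)): the Leibniz links of the H2-P derivative chain at EVERY ORDER — binomial product chains of matrix-valued
# (entrywise) and scalar-valued member families along a real slice, their Pascal derivative chain, bridges to the order ≤ 3 members of
# `FP/SliceLeibnizChain`, and the geometric («amplitude × ratioⁿ») letters.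

HONEST DEPENDENCY (page 1, mandatory): continuum YM on T⁴ ⇐ BetaPertH ∧ nine spine estimates (0/9 proved); BetaPertH ⇐ (D1) ∧ (D4) ∧ CAP+tail;
G-an2-4 gates asym, D1 and NE2/3/4.  HONEST FRAMING (cell contract, verbatim): «discharging `BetaPertH` makes Bałaban's UV stability UNCONDITIONAL —
a real constructive-QFT result; it is NOT the continuum limit and NOT the Clay problem.»  THIS MODULE DISCHARGES NOTHING of the wall: [folklore] one-variable
calculus — the product rule (`HasDerivAt.mul`, `FP/MatrixInvDeriv.hasDerivAt_mul_entry`), `HasDerivAt.sum`, and the Pascal step of a binomial convolution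
(Mathlib `Finset.sum_antidiagonal_choose_succ_nsmul`), `Nat.sum_range_choose`.
0 `def … : Prop`; nothing cited; 0 sorry; 0 wall binders; NOT D1, NOT BetaPertH, NOT continuum, NOT Clay.

ABSOLUTE RULE (cell charter, verbatim): «No internally-minted statement may enter as a cited fact. Every hypothesis is either kernel-proved in this package or a
verbatim quotation of a PUBLISHED theorem with page reference. The manuscript(s) under audit are NOT citable for their own disputed steps — they are the thing
under adjudication; programme-internal (2001/route/tribunal) claims are never citable.»

WHY (R-FP-21 (B), located finding F-gan24leaf01-g47-1).  The kernel letters (K2)/(K3) of H2-P-KER-ASM — first / second differences of the remainder kernel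
`K_B` of the unconstrained perfect propagator at the rates `‖z‖∞^{−4}` / `‖z‖∞^{−5}` — come from 4 resp. 5 one-dimensional integrations by parts
(`FP/PuncturedCoordDeriv.norm_latticeKernel_le_div_supNorm_pow r F …`, which is already typed at a free length `r` for a member family
`F μ : ℕ → (ℂ^{d+1} → ℂ)` with the slice-chain data `hder : ∀ j < r, HasDerivAt (F μ j ∘ slice) (F μ (j+1) …)`).  The H2-P chain feeding it
(`FP/SliceLeibnizChain`, `FP/SliceReciprocalChain`, `FP/RemainderSymbolChain`, `FP/RemainderSymbolSlice`) is typed member by member to order 3.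
This module is the order-parametric PRODUCT link in the SAME currency (explicit members `ℕ → ℝ → _`, pointwise `HasDerivAt` hypotheses, entrywise for
matrices — no global `ContDiff`, because the `W_∞` weight slices are only `ContDiffOn (|u| < π + δ₁₆₆)` and the inverse factors only exist on slices
missing the origin): for member families `X Y : ℕ → ℝ → Matrix ι ι ℂ` (resp. `u z : ℕ → ℝ → ℂ`) the `n`-th member of the product is the binomial
convolution `mmN X Y n t = Σ_{i+j=n} C(n,i)·X i t·Y j t`, and Pascal's rule makes `n ↦ mmN X Y n` a chain again.  SEARCH BEFORE PROVING: the
`iteratedDeriv`-currency twins exist — Mathlib `iteratedDeriv_fun_mul`, `Literature/Analysis/Calculus/IteratedDerivLeibnizBound.norm_iteratedDeriv_mul_le_of_geometric`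
(global `ContDiff`, normed algebra), `Literature/Barriers/CriticalPhenomena/LaceExpansionSymbolCalculus.abs_iteratedDeriv_mul_le_of_symbol` (real, ℤ-orders) —
and are the model for the letters below; they are not imported because their hypotheses (global `ContDiff ℝ n`) are not available on the punctured slices.

WHAT (`ι` a `Fintype` with `DecidableEq`; `t : ℝ`; all `n : ℕ` free).
* §1 `mmN X Y n t := Σ_{ij ∈ antidiagonal n} n.choose ij.1 • (X ij.1 t * Y ij.2 t)` (matrices), `mmN_apply` (entries), `mmN_zero`, **`mmN_succ`** (Pascal:
  `mmN X Y (n+1) t = Σ_{ij ∈ antidiagonal n} n.choose ij.1 • (X (ij.1+1) t * Y ij.2 t + X ij.1 t * Y (ij.2+1) t)`), bridges **`mmN_one∕two∕three`** to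
  `SliceLeibnizChain.mm1∕mm2∕mm3`; **`hasDerivAt_mmN`**: entrywise chains `(X j)′ = X (j+1)`, `(Y j)′ = Y (j+1)` at `t` for `j ≤ n` ⟹ `(mmN X Y n · α β)′ = mmN X Y (n+1) t α β`.
* §2 the scalar twin `ssN u z n t := Σ_{ij ∈ antidiagonal n} n.choose ij.1 • (u ij.1 t * z ij.2 t)`: `ssN_zero`, `ssN_succ`, `ssN_one∕two∕three` (↔ `ss1∕ss2∕ss3`),
  **`hasDerivAt_ssN`**.
* §3 GEOMETRIC LETTERS: `sum_antidiagonal_choose : Σ_{ij ∈ antidiagonal n} n.choose ij.1 = 2^n`; **`norm_mmN_le`**: `‖X j t γ δ‖ ≤ a·ρ^j`, `‖Y j t γ δ‖ ≤ b·ρ^j`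
  (`j ≤ n`, all entries) ⟹ `‖mmN X Y n t α β‖ ≤ card ι · 2^n · (a·b) · ρ^n`; **`norm_ssN_le`**: the same without `card ι`.  (Amplitudes multiply, ratios
  are shared, one factor `2^n` per product — the grading of H2-P-INV-N's `invDN` letters with `ρ = r⁻¹`; polynomial / truncated gradings `c·r^{(m−j)⁺}` on
  `0 < r ≤ R` are brought to this form with amplitude `c·r^m·max(R,1)^N`, `pow_trunc_le_geometric`.)
PART 2 (`FP/RemainderSymbolChainN`) composes these with an abstract inverse chain and the reciprocal of the dispersion; PART 3 instantiates on the
perfect propagator's slices.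

Provenance: binder row D1 formalisation swarm, lineage beta-d1-formalise-leaf-01, gen 8 (prover-b2b-balaban-beta-d1-formalise-leaf-01-g8-0), 2026-08-20;
sub-row H2-P-CHAIN-N of road FP (owner b2b-balaban-beta-d1-p3); the order ≤ 3 members are gan24-formalise-leaf-05-g34's `FP/SliceLeibnizChain` (untouched).
-/

noncomputable section

namespace Summit.QuantumFields.BalabanUV.Beta.FP.SliceChainN

open Matrix Finset
open scoped BigOperators
open Summit.QuantumFields.BalabanUV.Beta.FP.MatrixInvDeriv (hasDerivAt_mul_entry)
open Summit.QuantumFields.BalabanUV.Beta.FP.SliceLeibnizChain (mm1 mm2 mm3 ss1 ss2 ss3 norm_mul_entry_le)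

variable {ι : Type*} [Fintype ι]

/-- [folklore] membership in the antidiagonal bounds the first component. -/
theorem fst_le_of_mem_antidiagonal {n : ℕ} {ij : ℕ × ℕ} (h : ij ∈ antidiagonal n) : ij.1 ≤ n := by
  have := Finset.HasAntidiagonal.mem_antidiagonal.mp h; omega

/-- [folklore] membership in the antidiagonal bounds the second component. -/
theorem snd_le_of_mem_antidiagonal {n : ℕ} {ij : ℕ × ℕ} (h : ij ∈ antidiagonal n) : ij.2 ≤ n := by
  have := Finset.HasAntidiagonal.mem_antidiagonal.mp h; omega

/-! ## §1 Matrix × matrix, entrywise, every order -/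

section MM

/-- [our object] the `n`-th Leibniz member of a product of two matrix member families: the binomial convolution
`mmN X Y n t = Σ_{i+j=n} C(n,i) • (X i t * Y j t)`. -/
def mmN (X Y : ℕ → ℝ → Matrix ι ι ℂ) (n : ℕ) (t : ℝ) : Matrix ι ι ℂ :=
  ∑ ij ∈ antidiagonal n, n.choose ij.1 • (X ij.1 t * Y ij.2 t)

variable (X Y : ℕ → ℝ → Matrix ι ι ℂ)

/-- [folklore] the entries of `mmN`. -/
theorem mmN_apply (n : ℕ) (t : ℝ) (α β : ι) :
    mmN X Y n t α β = ∑ ij ∈ antidiagonal n, (n.choose ij.1 : ℂ) * (X ij.1 t * Y ij.2 t) α β := by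
  simp only [mmN, Matrix.sum_apply, Matrix.smul_apply]
  simp only [nsmul_eq_mul]

/-- [folklore] order zero is the product. -/
theorem mmN_zero (t : ℝ) : mmN X Y 0 t = X 0 t * Y 0 t := by
  simp [mmN]

/-- [folklore] **PASCAL**: `mmN X Y (n+1) t = Σ_{i+j=n} C(n,i) • (X (i+1) t * Y j t + X i t * Y (j+1) t)`. -/
theorem mmN_succ (n : ℕ) (t : ℝ) :
    mmN X Y (n + 1) t = ∑ ij ∈ antidiagonal n, n.choose ij.1 • (X (ij.1 + 1) t * Y ij.2 t + X ij.1 t * Y (ij.2 + 1) t) := by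
  unfold mmN
  rw [Finset.sum_antidiagonal_choose_succ_nsmul (fun i j => X i t * Y j t) n]
  rw [← Finset.sum_add_distrib]
  refine Finset.sum_congr rfl fun ij hij => ?_
  have h : n.choose ij.2 = n.choose ij.1 := by
    exact (Nat.choose_symm_of_eq_add (Finset.HasAntidiagonal.mem_antidiagonal.mp hij).symm).symm
  rw [h, smul_add, add_comm]

/-- [folklore] BRIDGE, order one: `mmN X Y 1 = mm1 (X 0) (X 1) (Y 0) (Y 1)`. -/
theorem mmN_one (t : ℝ) : mmN X Y 1 t = mm1 (X 0) (X 1) (Y 0) (Y 1) t := by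
  rw [mmN, Finset.Nat.sum_antidiagonal_eq_sum_range_succ_mk]
  simp [Finset.sum_range_succ, mm1, add_comm]

/-- [folklore] BRIDGE, order two: `mmN X Y 2 = mm2 (X 0) (X 1) (X 2) (Y 0) (Y 1) (Y 2)`. -/
theorem mmN_two (t : ℝ) : mmN X Y 2 t = mm2 (X 0) (X 1) (X 2) (Y 0) (Y 1) (Y 2) t := by
  rw [mmN, Finset.Nat.sum_antidiagonal_eq_sum_range_succ_mk]
  have h1 : Nat.choose 2 1 = 2 := by decide
  have h2 : Nat.choose 2 2 = 1 := by decide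
  simp only [Finset.sum_range_succ, Finset.sum_range_zero, zero_add, mm2, Nat.choose_zero_right, h1, h2, one_smul,
    Nat.sub_zero, Nat.sub_self, show 2 - 1 = 1 from rfl]
  abel

/-- [folklore] BRIDGE, order three: `mmN X Y 3 = mm3 (X 0) … (Y 3)`. -/
theorem mmN_three (t : ℝ) : mmN X Y 3 t = mm3 (X 0) (X 1) (X 2) (X 3) (Y 0) (Y 1) (Y 2) (Y 3) t := by
  rw [mmN, Finset.Nat.sum_antidiagonal_eq_sum_range_succ_mk]
  have h1 : Nat.choose 3 1 = 3 := by decide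
  have h2 : Nat.choose 3 2 = 3 := by decide
  have h3 : Nat.choose 3 3 = 1 := by decide
  simp only [Finset.sum_range_succ, Finset.sum_range_zero, zero_add, mm3, Nat.choose_zero_right, h1, h2, h3, one_smul,
    Nat.sub_zero, Nat.sub_self, show 3 - 1 = 2 from rfl, show 3 - 2 = 1 from rfl]
  abel

variable {X Y} {n : ℕ} {t : ℝ}

/-- [folklore] **THE CHAIN**: if `(X j · γ δ)′(t) = X (j+1) t γ δ` and `(Y j · γ δ)′(t) = Y (j+1) t γ δ` for all `j ≤ n` and all entries, then
`(mmN X Y n · α β)′(t) = mmN X Y (n+1) t α β`. -/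
theorem hasDerivAt_mmN [DecidableEq ι] (hX : ∀ j ≤ n, ∀ γ δ, HasDerivAt (fun s => X j s γ δ) (X (j + 1) t γ δ) t)
    (hY : ∀ j ≤ n, ∀ γ δ, HasDerivAt (fun s => Y j s γ δ) (Y (j + 1) t γ δ) t) (α β : ι) :
    HasDerivAt (fun s => mmN X Y n s α β) (mmN X Y (n + 1) t α β) t := by
  have e : (fun s => mmN X Y n s α β) = fun s => ∑ ij ∈ antidiagonal n, (n.choose ij.1 : ℂ) * (X ij.1 s * Y ij.2 s) α β := by
    funext s; exact mmN_apply X Y n s α β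
  have h : HasDerivAt (fun s => ∑ ij ∈ antidiagonal n, (n.choose ij.1 : ℂ) * (X ij.1 s * Y ij.2 s) α β)
      (∑ ij ∈ antidiagonal n, (n.choose ij.1 : ℂ) * ((X (ij.1 + 1) t * Y ij.2 t + X ij.1 t * Y (ij.2 + 1) t) α β)) t :=
    HasDerivAt.fun_sum fun ij hij =>
      ((hasDerivAt_mul_entry (hX ij.1 (fst_le_of_mem_antidiagonal hij)) (hY ij.2 (snd_le_of_mem_antidiagonal hij)) α β).const_mul _)
  have e' : ∑ ij ∈ antidiagonal n, (n.choose ij.1 : ℂ) * ((X (ij.1 + 1) t * Y ij.2 t + X ij.1 t * Y (ij.2 + 1) t) α β)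
      = mmN X Y (n + 1) t α β := by
    rw [mmN_succ, Matrix.sum_apply]
    refine Finset.sum_congr rfl fun ij _ => ?_
    rw [Matrix.smul_apply, nsmul_eq_mul]
  rw [e, ← e']
  exact h

end MM

/-! ## §2 Scalar × scalar, every order -/

section SS

/-- [our object] the `n`-th Leibniz member of a product of two scalar member families. -/
def ssN (u z : ℕ → ℝ → ℂ) (n : ℕ) (t : ℝ) : ℂ :=
  ∑ ij ∈ antidiagonal n, n.choose ij.1 • (u ij.1 t * z ij.2 t)

variable (u z : ℕ → ℝ → ℂ)

/-- [folklore] `ssN` with the binomial coefficients as complex numbers. -/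
theorem ssN_eq (n : ℕ) (t : ℝ) : ssN u z n t = ∑ ij ∈ antidiagonal n, (n.choose ij.1 : ℂ) * (u ij.1 t * z ij.2 t) := by
  simp only [ssN, nsmul_eq_mul]

/-- [folklore] order zero is the product. -/
theorem ssN_zero (t : ℝ) : ssN u z 0 t = u 0 t * z 0 t := by
  simp [ssN]

/-- [folklore] **PASCAL** for the scalar members. -/
theorem ssN_succ (n : ℕ) (t : ℝ) :
    ssN u z (n + 1) t = ∑ ij ∈ antidiagonal n, n.choose ij.1 • (u (ij.1 + 1) t * z ij.2 t + u ij.1 t * z (ij.2 + 1) t) := by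
  unfold ssN
  rw [Finset.sum_antidiagonal_choose_succ_nsmul (fun i j => u i t * z j t) n]
  rw [← Finset.sum_add_distrib]
  refine Finset.sum_congr rfl fun ij hij => ?_
  have h : n.choose ij.2 = n.choose ij.1 := by
    exact (Nat.choose_symm_of_eq_add (Finset.HasAntidiagonal.mem_antidiagonal.mp hij).symm).symm
  rw [h, smul_add, add_comm]

/-- [folklore] BRIDGE: `ssN u z 1 = ss1 (u 0) (u 1) (z 0) (z 1)`. -/
theorem ssN_one (t : ℝ) : ssN u z 1 t = ss1 (u 0) (u 1) (z 0) (z 1) t := by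
  rw [ssN, Finset.Nat.sum_antidiagonal_eq_sum_range_succ_mk]
  simp [Finset.sum_range_succ, ss1, add_comm]

/-- [folklore] BRIDGE: `ssN u z 2 = ss2 …`. -/
theorem ssN_two (t : ℝ) : ssN u z 2 t = ss2 (u 0) (u 1) (u 2) (z 0) (z 1) (z 2) t := by
  rw [ssN, Finset.Nat.sum_antidiagonal_eq_sum_range_succ_mk]
  have h1 : Nat.choose 2 1 = 2 := by decide
  have h2 : Nat.choose 2 2 = 1 := by decide
  simp only [Finset.sum_range_succ, Finset.sum_range_zero, zero_add, ss2, Nat.choose_zero_right, h1, h2,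
    Nat.sub_zero, Nat.sub_self, show 2 - 1 = 1 from rfl, nsmul_eq_mul]
  push_cast
  ring

/-- [folklore] BRIDGE: `ssN u z 3 = ss3 …`. -/
theorem ssN_three (t : ℝ) : ssN u z 3 t = ss3 (u 0) (u 1) (u 2) (u 3) (z 0) (z 1) (z 2) (z 3) t := by
  rw [ssN, Finset.Nat.sum_antidiagonal_eq_sum_range_succ_mk]
  have h1 : Nat.choose 3 1 = 3 := by decide
  have h2 : Nat.choose 3 2 = 3 := by decide
  have h3 : Nat.choose 3 3 = 1 := by decide
  simp only [Finset.sum_range_succ, Finset.sum_range_zero, zero_add, ss3, Nat.choose_zero_right, h1, h2, h3,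
    Nat.sub_zero, Nat.sub_self, show 3 - 1 = 2 from rfl, show 3 - 2 = 1 from rfl, nsmul_eq_mul]
  push_cast
  ring

variable {u z} {n : ℕ} {t : ℝ}

/-- [folklore] **THE CHAIN** for scalar members: `(u j)′(t) = u (j+1) t`, `(z j)′(t) = z (j+1) t` (`j ≤ n`) ⟹ `(ssN u z n)′(t) = ssN u z (n+1) t`. -/
theorem hasDerivAt_ssN (hu : ∀ j ≤ n, HasDerivAt (u j) (u (j + 1) t) t) (hz : ∀ j ≤ n, HasDerivAt (z j) (z (j + 1) t) t) :
    HasDerivAt (ssN u z n) (ssN u z (n + 1) t) t := by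
  have e : ssN u z n = fun s => ∑ ij ∈ antidiagonal n, (n.choose ij.1 : ℂ) * (u ij.1 s * z ij.2 s) := by
    funext s; exact ssN_eq u z n s
  have h : HasDerivAt (fun s => ∑ ij ∈ antidiagonal n, (n.choose ij.1 : ℂ) * (u ij.1 s * z ij.2 s))
      (∑ ij ∈ antidiagonal n, (n.choose ij.1 : ℂ) * (u (ij.1 + 1) t * z ij.2 t + u ij.1 t * z (ij.2 + 1) t)) t :=
    HasDerivAt.fun_sum fun ij hij =>
      (((hu ij.1 (fst_le_of_mem_antidiagonal hij)).mul (hz ij.2 (snd_le_of_mem_antidiagonal hij))).const_mul _)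
  have e' : ∑ ij ∈ antidiagonal n, (n.choose ij.1 : ℂ) * (u (ij.1 + 1) t * z ij.2 t + u ij.1 t * z (ij.2 + 1) t) = ssN u z (n + 1) t := by
    rw [ssN_succ]
    refine Finset.sum_congr rfl fun ij _ => ?_
    rw [nsmul_eq_mul]
  rw [e, ← e']
  exact h

end SS

/-! ## §3 Geometric letters -/

section Letters

omit [Fintype ι] in
/-- [folklore] `Σ_{i+j=n} C(n,i) = 2^n` (real form). -/
theorem sum_antidiagonal_choose (n : ℕ) : ∑ ij ∈ antidiagonal n, (n.choose ij.1 : ℝ) = 2 ^ n := by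
  rw [Finset.Nat.sum_antidiagonal_eq_sum_range_succ_mk]
  exact_mod_cast Nat.sum_range_choose n

/-- [folklore] TRUNCATED POLYNOMIAL GRADING ⟹ GEOMETRIC GRADING: on `0 < r ≤ R`, for `j ≤ N`,
`r^{(m−j)⁺} ≤ (r^m · max R 1 ^ N) · (r⁻¹)^j` — so letters `‖F j‖ ≤ c·r^{(m−j)⁺}` are letters `‖F j‖ ≤ (c·r^m·max R 1^N)·(r⁻¹)^j`. -/
theorem pow_trunc_le_geometric {r R : ℝ} (hr : 0 < r) (hrR : r ≤ R) {m j N : ℕ} (hj : j ≤ N) :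
    r ^ (m - j) ≤ r ^ m * max R 1 ^ N * r⁻¹ ^ j := by
  have hR1 : 1 ≤ max R 1 := le_max_right _ _
  have hrM : r ≤ max R 1 := hrR.trans (le_max_left _ _)
  rcases le_or_gt j m with hjm | hjm
  · -- `j ≤ m`: `r^{m-j} = r^m r^{-j} ≤ r^m · M^N · r^{-j}`
    have e : r ^ (m - j) = r ^ m * r⁻¹ ^ j := by
      rw [inv_pow, ← div_eq_mul_inv, eq_div_iff (pow_ne_zero _ hr.ne'), ← pow_add, Nat.sub_add_cancel hjm]
    rw [e]
    have h1 : r ^ m * r⁻¹ ^ j = r ^ m * 1 * r⁻¹ ^ j := by ring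
    rw [h1]
    exact mul_le_mul_of_nonneg_right (mul_le_mul_of_nonneg_left (one_le_pow₀ hR1) (pow_nonneg hr.le _))
      (pow_nonneg (inv_nonneg.mpr hr.le) _)
  · -- `m < j`: `r^0 = 1 ≤ r^m M^N r^{-j}` since `r^{-(j-m)} ≥ M^{-(j-m)} ≥ M^{-N}`
    have hsub : m - j = 0 := by omega
    rw [hsub, pow_zero]
    have e : r ^ m * max R 1 ^ N * r⁻¹ ^ j = max R 1 ^ N * r⁻¹ ^ (j - m) := by
      have : j = m + (j - m) := by omega
      conv_lhs => rw [this, pow_add]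
      rw [inv_pow, inv_pow]
      field_simp
    rw [e]
    have h2 : (1 : ℝ) ≤ max R 1 ^ (j - m) * r⁻¹ ^ (j - m) := by
      rw [← mul_pow]
      refine one_le_pow₀ ?_
      rw [le_mul_inv_iff₀ hr, one_mul]
      exact hrM
    calc (1 : ℝ) ≤ max R 1 ^ (j - m) * r⁻¹ ^ (j - m) := h2
      _ ≤ max R 1 ^ N * r⁻¹ ^ (j - m) :=
        mul_le_mul_of_nonneg_right (pow_le_pow_right₀ hR1 (by omega)) (pow_nonneg (inv_nonneg.mpr hr.le) _)

variable {X Y : ℕ → ℝ → Matrix ι ι ℂ} {u z : ℕ → ℝ → ℂ} {n : ℕ} {t a b ρ : ℝ}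

/-- [our object] **GEOMETRIC LETTERS FOR THE MATRIX PRODUCT CHAIN**: `‖X j t γ δ‖ ≤ a·ρ^j`, `‖Y j t γ δ‖ ≤ b·ρ^j` for `j ≤ n` and all entries (`0 ≤ ρ`)
⟹ `‖mmN X Y n t α β‖ ≤ card ι · 2^n · (a·b) · ρ^n` (no sign condition on `ρ` is needed: the exponents add up to `n`). -/
theorem norm_mmN_le [DecidableEq ι] (bX : ∀ j ≤ n, ∀ γ δ, ‖X j t γ δ‖ ≤ a * ρ ^ j) (bY : ∀ j ≤ n, ∀ γ δ, ‖Y j t γ δ‖ ≤ b * ρ ^ j)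
    (α β : ι) : ‖mmN X Y n t α β‖ ≤ Fintype.card ι * 2 ^ n * (a * b) * ρ ^ n := by
  rw [mmN_apply]
  have ha : 0 ≤ a := by simpa using (norm_nonneg _).trans (bX 0 (Nat.zero_le _) α α)
  have hterm : ∀ ij ∈ antidiagonal n,
      ‖(n.choose ij.1 : ℂ) * (X ij.1 t * Y ij.2 t) α β‖ ≤ (n.choose ij.1 : ℝ) * (Fintype.card ι * (a * b) * ρ ^ n) := by
    intro ij hij
    have hn : ij.1 + ij.2 = n := Finset.HasAntidiagonal.mem_antidiagonal.mp hij
    have h := norm_mul_entry_le (bX ij.1 (fst_le_of_mem_antidiagonal hij)) (bY ij.2 (snd_le_of_mem_antidiagonal hij)) α β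
    rw [norm_mul, Complex.norm_natCast]
    refine mul_le_mul_of_nonneg_left (h.trans (le_of_eq ?_)) (Nat.cast_nonneg _)
    rw [← hn, pow_add]; ring
  calc ‖∑ ij ∈ antidiagonal n, (n.choose ij.1 : ℂ) * (X ij.1 t * Y ij.2 t) α β‖
      ≤ ∑ ij ∈ antidiagonal n, ‖(n.choose ij.1 : ℂ) * (X ij.1 t * Y ij.2 t) α β‖ := norm_sum_le _ _
    _ ≤ ∑ ij ∈ antidiagonal n, (n.choose ij.1 : ℝ) * (Fintype.card ι * (a * b) * ρ ^ n) := Finset.sum_le_sum hterm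
    _ = (∑ ij ∈ antidiagonal n, (n.choose ij.1 : ℝ)) * (Fintype.card ι * (a * b) * ρ ^ n) := by rw [Finset.sum_mul]
    _ = Fintype.card ι * 2 ^ n * (a * b) * ρ ^ n := by rw [sum_antidiagonal_choose]; ring

omit [Fintype ι] in
/-- [our object] **GEOMETRIC LETTERS FOR THE SCALAR PRODUCT CHAIN**: `‖u j t‖ ≤ a·ρ^j`, `‖z j t‖ ≤ b·ρ^j` (`j ≤ n`, `0 ≤ ρ`) ⟹ `‖ssN u z n t‖ ≤ 2^n·(a·b)·ρ^n`. -/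
theorem norm_ssN_le (hρ : 0 ≤ ρ) (bu : ∀ j ≤ n, ‖u j t‖ ≤ a * ρ ^ j) (bz : ∀ j ≤ n, ‖z j t‖ ≤ b * ρ ^ j) :
    ‖ssN u z n t‖ ≤ 2 ^ n * (a * b) * ρ ^ n := by
  rw [ssN_eq]
  have ha : 0 ≤ a := by simpa using (norm_nonneg _).trans (bu 0 (Nat.zero_le _))
  have hterm : ∀ ij ∈ antidiagonal n, ‖(n.choose ij.1 : ℂ) * (u ij.1 t * z ij.2 t)‖ ≤ (n.choose ij.1 : ℝ) * ((a * b) * ρ ^ n) := by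
    intro ij hij
    have hn : ij.1 + ij.2 = n := Finset.HasAntidiagonal.mem_antidiagonal.mp hij
    have h1 := bu ij.1 (fst_le_of_mem_antidiagonal hij)
    have h2 := bz ij.2 (snd_le_of_mem_antidiagonal hij)
    rw [norm_mul, Complex.norm_natCast, norm_mul]
    refine mul_le_mul_of_nonneg_left ?_ (Nat.cast_nonneg _)
    calc ‖u ij.1 t‖ * ‖z ij.2 t‖ ≤ (a * ρ ^ ij.1) * (b * ρ ^ ij.2) :=
          mul_le_mul h1 h2 (norm_nonneg _) (mul_nonneg ha (pow_nonneg hρ _))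
      _ = (a * b) * ρ ^ n := by rw [← hn, pow_add]; ring
  calc ‖∑ ij ∈ antidiagonal n, (n.choose ij.1 : ℂ) * (u ij.1 t * z ij.2 t)‖
      ≤ ∑ ij ∈ antidiagonal n, ‖(n.choose ij.1 : ℂ) * (u ij.1 t * z ij.2 t)‖ := norm_sum_le _ _
    _ ≤ ∑ ij ∈ antidiagonal n, (n.choose ij.1 : ℝ) * ((a * b) * ρ ^ n) := Finset.sum_le_sum hterm
    _ = (∑ ij ∈ antidiagonal n, (n.choose ij.1 : ℝ)) * ((a * b) * ρ ^ n) := by rw [Finset.sum_mul]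
    _ = 2 ^ n * (a * b) * ρ ^ n := by rw [sum_antidiagonal_choose]; ring

end Letters

end Summit.QuantumFields.BalabanUV.Beta.FP.SliceChainN

end
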